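import Summits.QuantumFields.YangMills.Theorems.FluctuationComparisonRegPrIntLS1aCentreLegResponse
import Literature.MathematicalPhysics.QuantumFieldTheory.Balaban1983to89.BlockAveragingExpMeanLogContinuous
import HarnessLib

/-!
# Route `UnitScaleTilt`, crux K1b-INT `FluctuationComparisonRegPrIntL` (stmt-QuantumFields-20520) — S1aᴴ `RunClassMembershipH`, conjuncts (a)∕(c):
# ROBUST LOCAL SURJECTIVITY OF THE CENTRE-LEG LAW — every coarse value near `Ū(U₀)(c)` is attained by moving ONE fine bond, the centre leg
# `⟨emb c₋, ν⟩`, uniformly over all small-field backgrounds `U₀`; a chart-free Newton iteration in `SU(N)` driven by FILE B's response letter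

Cell `ym3-torus` (rung R3: SU(2) YM₃ on T³ — NOT d = 4, NOT infinite volume, NOT a mass gap, NOT Clay), width seat `ym3-torus-px13` g24
(helper on the crux, `--supports stmt-QuantumFields-20520`, def-free).  FILE 2 of the centre-leg series (FILE A ✓`…S1aCentreLegOccurrence`,
FILE B ✓`…S1aCentreLegResponse`).

WHY.  The transversality lemma (T⊥) of UV3-NODE §67.7–§67.9 at SMALL fields (the existence half of S1aᴴ's analyticity conjunct (a) and the
continuity conjunct (c) for sharply cut small-field densities of the (0.4) cascade; equally needed by print's `χ·exp(eff)` towers) reduces in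
the resampling coordinates of ✓`…SubmersionEngine` to: (FIB) robust local surjectivity of the PRIVATE one-variable laws (✓`…OneStepSubmersion`)
plus (E2) the same for ONE NON-private bond per coarse bond.  This file is (E2) for the centre leg: with it, a driver move of the private bond
`β(c)` (which moves the member loop ∕ the central-edge plaquette) is compensated EXACTLY on `Ū(c)` by the centre leg, and the centre leg's
side effects on the other coarse bonds are compensated by their private laws — (T⊥)(ii)+(iii) at small fields becomes bookkeeping.

THE MATHEMATICS ([folklore] Newton iteration; the only analytic input is FILE B's specialisation of [Balaban1985Averaging] Prop. 3 (122)–(124)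
at a background, ✓`BlockAveragingEMLLinearisedBackground.norm_avgFun_ratio_sub_one_sub_covLinAvg_le`).  `K(g) := Ū(update U₀ e′ (g·U₀e′))(c)`,
target `T`, residual `R := T·K(g)* − 1`.  The update `g⁺ := (T·K(g)⁻¹)·g` is a centre-leg perturbation of the MOVED background by
`h = T·K(g)⁻¹`, `‖h − 1‖ = ‖R‖`, so FILE B gives `K(g⁺)K(g)* = 1 + κ•R + E`, `‖E‖ ≤ 400ℓ‖R‖(ℓ‖R‖ + α + dist1 g)`, `κ = s′∕|I| ∈ (0, 1]`;
since `T·K(g)*` is unitary the quadratic terms cancel EXACTLY: `T·K(g⁺)* − 1 = (1 − κ)•R + (T·K(g)*)·E*` (`residual_identity`), whence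
`‖R⁺‖ ≤ ((1 − κ) + 400ℓ(ℓ‖R‖ + α + dist1 g))·‖R‖` (`newton_step`).  Under `800ℓ(ℓρ + α + 2ρ∕κ) ≤ κ` the ratio is `≤ 1 − κ∕2`, the
displacements sum to `≤ 2ρ∕κ`, the sequence is Cauchy in the compact group, and `K` is continuous at the limit (deep inside the guard the
guarded average agrees with the continuous inhabitant `expMeanLogSUc`, §3) — `centreLeg_surjective`.

WHAT THIS FILE PROVES (theorems only; `Params` arbitrary in the standing range; `SU(N)`, `N` finite non-empty):
* §1 `residual_identity`, `norm_residual_le` — the Newton-step algebra.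
* §2 `update_centreLeg_mul`, `kappa_le_one`, `kappa_pos`; ★★ `newton_step`.
* §3 `continuousAt_avgFun_apply` — `U ↦ Ū(U)(c)` (guarded `expMeanLogSU`) is continuous at every `U₁` whose loop variables at `c` are
  within `δ_N∕2` of `1`.
* §4 ★★★ `centreLeg_surjective` — for `U₀` with loop variables at `c` within `α`, `κ = s′∕|I|`, `ρ` with `α + 2ρ∕κ ≤ 1∕24`, `48ℓρ ≤ 1`,
  `2ℓρ + α + 2ρ∕κ < δ_N∕2`, `800ℓ(ℓρ + α + 2ρ∕κ) ≤ κ`: every `T ∈ SU(N)` with `‖T·Ū(U₀)(c)* − 1‖ ≤ ρ` equals `Ū(update U₀ e′ (g·U₀e′))(c)`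
  for some `g` with `‖g − 1‖ ≤ 2ρ∕κ`.  (The thresholds are satisfiable: `κ ≥ 1∕|I| > 0` by FILE A's `one_le_card_centreLeg`.)

HONEST SCOPE.  Elementary analysis over two landed letters; nothing of Bałaban's analysis beyond the cited tree theorem; (T⊥) itself (the
bookkeeping with (FIB)), S1aᴴ, the five registered stubs of `Lines/semiclassical_s2beta.lean`, crux 20520 and `YM3TorusSU2` are NOT proved;
the Yang–Mills mass gap is NOT proved.
-/

set_option autoImplicit false

noncomputable section

open scoped Matrix.Norms.L2Operator Topology
open Filter

namespace Summit.QuantumFields.YangMills.Theorems.FluctuationComparisonRegPrIntLS1aCentreLegSurjective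

open Literature.MathematicalPhysics.QuantumFieldTheory.Balaban1983to89
open T4Continuum AveragingRT BlockAveraging ExpMeanLog
open BlockAveragingEMLLinearised BlockAveragingEMLLinearisedBackground
open Summit.QuantumFields.YangMills.Theorems.FluctuationComparisonRegPrIntLS1aCentreLegOccurrence
open Summit.QuantumFields.YangMills.Theorems.FluctuationComparisonRegPrIntLS1aCentreLegResponse

variable {n : Type*} [Fintype n] [DecidableEq n] {P : Params} {j : ℕ} [DecidableEq (PBond P j)]

/-! ## §1 Algebra of one Newton step: the quadratic terms cancel -/

/-- **ONE NEWTON STEP, ALGEBRA.**  If `V := T·K*` is unitary, `R := V − 1`, and the new value `K⁺` satisfies `K⁺·K* = 1 + κ•R + E`, then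
the new residual is `T·K⁺* − 1 = (1 − κ)•R + V·E*` — the quadratic terms cancel identically because `V·R* = −R`. [folklore] -/
theorem residual_identity {T K K' V R E : Matrix n n ℂ} {κ : ℝ} (hK : star K * K = 1) (hV : V = T * star K)
    (hVu : V * star V = 1) (hR : R = V - 1) (hA : K' * star K = 1 + (κ : ℂ) • R + E) :
    T * star K' - 1 = ((1 - κ : ℝ) : ℂ) • R + V * star E := by
  have hK' : star K' = star K * star (1 + (κ : ℂ) • R + E) := by
    have : K' = (1 + (κ : ℂ) • R + E) * K := by
      calc K' = K' * (star K * K) := by rw [hK, mul_one]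
        _ = (K' * star K) * K := by rw [mul_assoc]
        _ = (1 + (κ : ℂ) • R + E) * K := by rw [hA]
    rw [this, star_mul]
  have hVR : V * star R = -R := by
    rw [hR, star_sub, star_one, mul_sub, mul_one, hVu]; abel
  rw [hK', ← mul_assoc, ← hV, star_add, star_add, star_one, star_smul, Complex.star_def, Complex.conj_ofReal,
    mul_add, mul_add, mul_one, mul_smul_comm, hVR, hR]
  push_cast
  simp only [sub_smul, one_smul, smul_neg]
  abel

/-- Norm form of the Newton step: `‖T·K⁺* − 1‖ ≤ (1 − κ)·‖R‖ + ‖E‖` (`0 ≤ κ ≤ 1`, `V` unitary). [folklore] -/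
theorem norm_residual_le [Nonempty n] {T K K' V R E : Matrix n n ℂ} {κ : ℝ} (hK : star K * K = 1) (hV : V = T * star K)
    (hVmem : V ∈ Matrix.unitaryGroup n ℂ) (hR : R = V - 1) (hA : K' * star K = 1 + (κ : ℂ) • R + E) (hκ1 : κ ≤ 1) :
    ‖T * star K' - 1‖ ≤ (1 - κ) * ‖R‖ + ‖E‖ := by
  have hVu : V * star V = 1 := Unitary.mul_star_self_of_mem hVmem
  rw [residual_identity hK hV hVu hR hA]
  refine (norm_add_le _ _).trans (add_le_add ?_ ?_)
  · rw [norm_smul, Complex.norm_real, Real.norm_of_nonneg (by linarith)]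
  · calc ‖V * star E‖ ≤ ‖V‖ * ‖star E‖ := norm_mul_le _ _
      _ = ‖E‖ := by rw [CStarRing.norm_of_mem_unitary hVmem, one_mul, norm_star]

/-! ## §2 One step of the iteration for the centre-leg law -/

/-- Two successive centre-leg updates compose: updating `U(e) = g·U₀(e)` once more by `h` gives `U(e) = (h·g)·U₀(e)`. [folklore] -/
theorem update_centreLeg_mul {G : Type*} [Group G] (U₀ : GaugeField P j G) (e : PBond P j) (g h : G) :
    Function.update (Function.update U₀ e (g * U₀ e)) e (h * Function.update U₀ e (g * U₀ e) e) =
      Function.update U₀ e ((h * g) * U₀ e) := by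
  rw [Function.update_self, Function.update_idem, mul_assoc]

/-- `s′∕|I| ≤ 1`. [folklore] -/
theorem kappa_le_one (ν : Fin P.d) :
    ((Fintype.card (Idx P) : ℝ))⁻¹ *
        ((Finset.univ.filter fun i : Idx P => (stairWord i.2.1 (off i.1)).head? = some (ν, true)).card : ℝ) ≤ 1 := by
  have hc : (0 : ℝ) < Fintype.card (Idx P) := Nat.cast_pos.mpr Fintype.card_pos
  rw [inv_mul_le_iff₀ hc, mul_one]
  exact_mod_cast Finset.card_filter_le _ _ |>.trans (Finset.card_univ (α := Idx P)).le

/-- `0 < s′∕|I|`. [folklore] -/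
theorem kappa_pos (ν : Fin P.d) :
    0 < ((Fintype.card (Idx P) : ℝ))⁻¹ *
        ((Finset.univ.filter fun i : Idx P => (stairWord i.2.1 (off i.1)).head? = some (ν, true)).card : ℝ) := by
  have hc : (0 : ℝ) < Fintype.card (Idx P) := Nat.cast_pos.mpr Fintype.card_pos
  have h1 := one_le_card_centreLeg (P := P) ν
  exact mul_pos (inv_pos.mpr hc) (by exact_mod_cast h1)

/-- **ONE NEWTON STEP FOR THE CENTRE-LEG LAW.**  Background `U₀` with loop variables at `c` within `α`; current centre-leg value
`g·U₀(e′)`, target `T`, residual `r ≥ ‖T·Ū(g)* − 1‖`; if `α + dist1 g ≤ 1∕24`, `48ℓr ≤ 1`, `2ℓr + (α + dist1 g) < δ_N`, then the Newton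
update `g⁺ := (T·Ū(g)⁻¹)·g` has residual `‖T·Ū(g⁺)* − 1‖ ≤ ((1 − κ) + 400ℓ(ℓr + α + dist1 g))·r`, `κ = s′∕|I|` — FILE B's letter at the
moved background plus §1. [cite: Balaban1985Averaging, Prop. 3 (122)-(124) p.36] -/
theorem newton_step [Nonempty n] (hj : j + 1 ≤ P.m + P.K) (U₀ : GaugeField P j (Matrix.specialUnitaryGroup n ℂ)) (c : PBond P (j + 1))
    {ν : Fin P.d} (hν : ν ≠ c.dir) {α : ℝ} (hα : ∀ i, dist1 (loopHol U₀ c i) ≤ α)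
    (g T : Matrix.specialUnitaryGroup n ℂ) {r : ℝ}
    (hr : ‖(T : Matrix n n ℂ) * star ((avgFun (expMeanLogSU (n := n))
        (Function.update U₀ ⟨emb c.src, ν⟩ (g * U₀ ⟨emb c.src, ν⟩)) c : Matrix.specialUnitaryGroup n ℂ) : Matrix n n ℂ) - 1‖ ≤ r)
    (h24 : α + dist1 g ≤ 1 / 24) (h48 : 48 * ((((P.d + 2) * P.L : ℕ) : ℝ) * r) ≤ 1)
    (hN : 2 * ((((P.d + 2) * P.L : ℕ) : ℝ) * r) + (α + dist1 g) < deltaSU n) :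
    ‖(T : Matrix n n ℂ) * star ((avgFun (expMeanLogSU (n := n))
        (Function.update U₀ ⟨emb c.src, ν⟩
          ((T * (avgFun (expMeanLogSU (n := n)) (Function.update U₀ ⟨emb c.src, ν⟩ (g * U₀ ⟨emb c.src, ν⟩)) c)⁻¹) * g *
            U₀ ⟨emb c.src, ν⟩)) c : Matrix.specialUnitaryGroup n ℂ) : Matrix n n ℂ) - 1‖ ≤
      ((1 - ((Fintype.card (Idx P) : ℝ))⁻¹ *
            ((Finset.univ.filter fun i : Idx P => (stairWord i.2.1 (off i.1)).head? = some (ν, true)).card : ℝ)) +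
          400 * (((P.d + 2) * P.L : ℕ) : ℝ) * ((((P.d + 2) * P.L : ℕ) : ℝ) * r + (α + dist1 g))) * r := by
  classical
  -- letters
  set e : PBond P j := ⟨emb c.src, ν⟩ with he
  set U₁ : GaugeField P j (Matrix.specialUnitaryGroup n ℂ) := Function.update U₀ e (g * U₀ e) with hU₁
  set K : Matrix.specialUnitaryGroup n ℂ := avgFun (expMeanLogSU (n := n)) U₁ c with hKdef
  set h : Matrix.specialUnitaryGroup n ℂ := T * K⁻¹ with hh
  set κ : ℝ := ((Fintype.card (Idx P) : ℝ))⁻¹ *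
      ((Finset.univ.filter fun i : Idx P => (stairWord i.2.1 (off i.1)).head? = some (ν, true)).card : ℝ) with hκ
  have hr0 : 0 ≤ r := (norm_nonneg _).trans hr
  -- the moved background has loop variables within `α + dist1 g`
  have hα₁ : ∀ i, dist1 (loopHol U₁ c i) ≤ α + dist1 g := fun i => by
    rw [hU₁, he]
    have := dist1_loopHol_update_centreLeg_le hj U₀ c hν g i
    linarith [hα i]
  -- the perturbation `h = T·K⁻¹` has `‖h − 1‖ ≤ r`
  have hcoeh : ((h : Matrix.specialUnitaryGroup n ℂ) : Matrix n n ℂ) = (T : Matrix n n ℂ) * star (K : Matrix n n ℂ) := by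
    rw [hh, Submonoid.coe_mul]; rfl
  have hhr : ‖((h : Matrix.specialUnitaryGroup n ℂ) : Matrix n n ℂ) - 1‖ ≤ r := by rw [hcoeh]; exact hr
  -- FILE B's letter at the background `U₁`
  have key := centreLeg_response hj U₁ c hν hr0 hα₁ h24 h48 hN h hhr
  rw [hU₁, he, update_centreLeg_mul] at key
  -- §1 with `V = T·K*`
  have hKu : ((K : Matrix.specialUnitaryGroup n ℂ) : Matrix n n ℂ) ∈ Matrix.unitaryGroup n ℂ :=
    (Matrix.mem_specialUnitaryGroup_iff.1 K.2).1
  have hTu : ((T : Matrix.specialUnitaryGroup n ℂ) : Matrix n n ℂ) ∈ Matrix.unitaryGroup n ℂ :=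
    (Matrix.mem_specialUnitaryGroup_iff.1 T.2).1
  have hstarK : star ((K : Matrix.specialUnitaryGroup n ℂ) : Matrix n n ℂ) * (K : Matrix n n ℂ) = 1 :=
    Unitary.star_mul_self_of_mem hKu
  have hVmem : (T : Matrix n n ℂ) * star ((K : Matrix.specialUnitaryGroup n ℂ) : Matrix n n ℂ) ∈ Matrix.unitaryGroup n ℂ :=
    Submonoid.mul_mem _ hTu (Unitary.star_mem hKu)
  have hκ1 : κ ≤ 1 := kappa_le_one (P := P) ν
  have hcast : (((Fintype.card (Idx P) : ℂ))⁻¹ *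
      ((Finset.univ.filter fun i : Idx P => (stairWord i.2.1 (off i.1)).head? = some (ν, true)).card : ℂ)) = ((κ : ℝ) : ℂ) := by
    rw [hκ]; push_cast; rfl
  rw [hcast, hcoeh] at key
  -- `key : ‖K' K* − 1 − κ • R‖ ≤ ε`; write `K' K* = 1 + κ•R + E`
  set K' : Matrix n n ℂ := ((avgFun (expMeanLogSU (n := n)) (Function.update U₀ ⟨emb c.src, ν⟩ ((h * g) * U₀ ⟨emb c.src, ν⟩)) c :
      Matrix.specialUnitaryGroup n ℂ) : Matrix n n ℂ) with hK'
  set R : Matrix n n ℂ := (T : Matrix n n ℂ) * star ((K : Matrix.specialUnitaryGroup n ℂ) : Matrix n n ℂ) - 1 with hRdef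
  set E : Matrix n n ℂ := K' * star ((K : Matrix.specialUnitaryGroup n ℂ) : Matrix n n ℂ) - 1 - ((κ : ℝ) : ℂ) • R with hEdef
  have hA : K' * star ((K : Matrix.specialUnitaryGroup n ℂ) : Matrix n n ℂ) = 1 + ((κ : ℝ) : ℂ) • R + E := by
    rw [hEdef]; abel
  have step := norm_residual_le (T := (T : Matrix n n ℂ)) hstarK rfl hVmem rfl hA hκ1
  have hEle : ‖E‖ ≤ 400 * ((((P.d + 2) * P.L : ℕ) : ℝ) * r) * ((((P.d + 2) * P.L : ℕ) : ℝ) * r + (α + dist1 g)) := by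
    rw [hEdef, hRdef]; exact key
  have hRle : ‖R‖ ≤ r := hr
  have h1κ : 0 ≤ 1 - κ := by linarith
  -- conclude
  have hfinal : ‖(T : Matrix n n ℂ) * star K' - 1‖ ≤ (1 - κ) * r +
      400 * ((((P.d + 2) * P.L : ℕ) : ℝ) * r) * ((((P.d + 2) * P.L : ℕ) : ℝ) * r + (α + dist1 g)) :=
    step.trans (add_le_add (mul_le_mul_of_nonneg_left hRle h1κ) hEle)
  calc ‖(T : Matrix n n ℂ) * star K' - 1‖ ≤ _ := hfinal
    _ = _ := by ring

/-! ## §3 Continuity of the guarded average at fields deep inside the guard -/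

omit [DecidableEq (PBond P j)] in
/-- Deep inside the guard (`dist1` of every loop variable at `c` below `δ_N∕2`) the guarded average `Ū(c)` of (0.4) with `expMeanLogSU`
agrees near `U₁` with the continuous inhabitant `expMeanLogSUc`, hence is continuous at `U₁`. [cite: Balaban1987RG1, (0.4) p.253] -/
theorem continuousAt_avgFun_apply [Nonempty n] (U₁ : GaugeField P j (Matrix.specialUnitaryGroup n ℂ)) (c : PBond P (j + 1))
    (h : ∀ i, dist1 (loopHol U₁ c i) < deltaSU n / 2) :
    ContinuousAt (fun U : GaugeField P j (Matrix.specialUnitaryGroup n ℂ) => avgFun (expMeanLogSU (n := n)) U c) U₁ := by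
  classical
  have hcont : Continuous fun U : GaugeField P j (Matrix.specialUnitaryGroup n ℂ) => avgFun (expMeanLogSUc (n := n)) U c :=
    (continuous_apply c).comp continuous_avgFun_expMeanLogSUc
  -- the open set where every loop variable is below `δ_N / 2`
  have hdist : ∀ i, Continuous fun U : GaugeField P j (Matrix.specialUnitaryGroup n ℂ) => dist1 (loopHol U c i) := fun i => by
    have h1 : (fun U : GaugeField P j (Matrix.specialUnitaryGroup n ℂ) => dist1 (loopHol U c i)) =
        fun U => ‖((loopHol U c i : Matrix.specialUnitaryGroup n ℂ) : Matrix n n ℂ) - 1‖ :=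
      funext fun U => FederbushMean.dist1_SU_eq _
    rw [h1]
    exact ((continuous_subtype_val.comp ((continuous_apply i).comp (continuous_loopHol c))).sub continuous_const).norm
  have hO : IsOpen {U : GaugeField P j (Matrix.specialUnitaryGroup n ℂ) | ∀ i, dist1 (loopHol U c i) < deltaSU n / 2} := by
    rw [Set.setOf_forall]
    exact isOpen_iInter_of_finite fun i => isOpen_lt (hdist i) continuous_const
  have heq : ∀ U ∈ {U : GaugeField P j (Matrix.specialUnitaryGroup n ℂ) | ∀ i, dist1 (loopHol U c i) < deltaSU n / 2},
      avgFun (expMeanLogSUc (n := n)) U c = avgFun (expMeanLogSU (n := n)) U c := by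
    intro U hU
    have hsmall : Small (expMeanLogSU (n := n)) U c := fun i =>
      (hU i).trans (by have := deltaSU_pos (n := n); show deltaSU n / 2 < (expMeanLogSU (n := n)).δ; simp [expMeanLogSU]; linarith)
    show corr (expMeanLogSUc (n := n)) U c * axialAvg U c = corr (expMeanLogSU (n := n)) U c * axialAvg U c
    congr 1
    rw [corr_expMeanLogSUc_eq, corr, if_pos hsmall]
    unfold LoopAverage.avg
    exact expMeanLogSUc_E_eq _ fun i => (hU _).le
  refine (hcont.continuousAt).congr (Filter.eventuallyEq_of_mem (hO.mem_nhds h) heq)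

/-! ## §4 The Newton iteration converges: robust local surjectivity of the centre-leg law -/

/-- **ROBUST LOCAL SURJECTIVITY OF THE CENTRE-LEG LAW.**  Let the (0.4) loop variables of `U₀` at `c` be within `α` of `1`, `ν ≠ c.dir`,
`e′ = ⟨emb c₋, ν⟩`, `κ = s′∕|I|` (FILE B's scalar), `ℓ = (d+2)L`, and `ρ ≥ 0` with `α + 2ρ∕κ ≤ 1∕24`, `48ℓρ ≤ 1`,
`2ℓρ + α + 2ρ∕κ < δ_N∕2`, `800ℓ(ℓρ + α + 2ρ∕κ) ≤ κ`.  Then EVERY `T ∈ SU(N)` with `‖T·Ū(U₀)(c)* − 1‖ ≤ ρ` is attained: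
`Ū(update U₀ e′ (g·U₀ e′))(c) = T` for some `g` with `‖g − 1‖ ≤ 2ρ∕κ`.  Proof: the Newton iteration `g₀ = 1`,
`g_{k+1} = (T·Ū(g_k)⁻¹)·g_k` has residuals `≤ (1 − κ∕2)^k ρ` (`newton_step`), is Cauchy in the compact group, and the law is
continuous at the limit (§3). The hypotheses are uniform in `U₀`: this is the environment-robust surjectivity the transversality
lemma (T⊥) at small fields consumes. [cite: Balaban1985Averaging, Prop. 3 (122)-(124) p.36] -/
theorem centreLeg_surjective [Nonempty n] (hj : j + 1 ≤ P.m + P.K) (U₀ : GaugeField P j (Matrix.specialUnitaryGroup n ℂ))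
    (c : PBond P (j + 1)) {ν : Fin P.d} (hν : ν ≠ c.dir) {α ρ : ℝ} (κ : ℝ)
    (hκ : κ = ((Fintype.card (Idx P) : ℝ))⁻¹ *
      ((Finset.univ.filter fun i : Idx P => (stairWord i.2.1 (off i.1)).head? = some (ν, true)).card : ℝ))
    (hα : ∀ i, dist1 (loopHol U₀ c i) ≤ α)
    (hA : α + 2 * ρ / κ ≤ 1 / 24) (hB : 48 * ((((P.d + 2) * P.L : ℕ) : ℝ) * ρ) ≤ 1)
    (hC : 2 * ((((P.d + 2) * P.L : ℕ) : ℝ) * ρ) + (α + 2 * ρ / κ) < deltaSU n / 2)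
    (hD : 800 * (((P.d + 2) * P.L : ℕ) : ℝ) * ((((P.d + 2) * P.L : ℕ) : ℝ) * ρ + (α + 2 * ρ / κ)) ≤ κ)
    (T : Matrix.specialUnitaryGroup n ℂ)
    (hT : ‖(T : Matrix n n ℂ) * star ((avgFun (expMeanLogSU (n := n)) U₀ c : Matrix.specialUnitaryGroup n ℂ) : Matrix n n ℂ) - 1‖ ≤ ρ) :
    ∃ g : Matrix.specialUnitaryGroup n ℂ, ‖(g : Matrix n n ℂ) - 1‖ ≤ 2 * ρ / κ ∧
      avgFun (expMeanLogSU (n := n)) (Function.update U₀ ⟨emb c.src, ν⟩ (g * U₀ ⟨emb c.src, ν⟩)) c = T := by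
  classical
  -- letters
  set ℓ : ℝ := (((P.d + 2) * P.L : ℕ) : ℝ) with hℓ
  set e : PBond P j := ⟨emb c.src, ν⟩ with he
  set K : Matrix.specialUnitaryGroup n ℂ → Matrix.specialUnitaryGroup n ℂ :=
    fun g => avgFun (expMeanLogSU (n := n)) (Function.update U₀ e (g * U₀ e)) c with hKdef
  have hκpos : 0 < κ := by rw [hκ]; exact kappa_pos (P := P) ν
  have hκ1 : κ ≤ 1 := by rw [hκ]; exact kappa_le_one (P := P) ν
  have hρ0 : 0 ≤ ρ := (norm_nonneg _).trans hT
  have hℓ0 : 0 ≤ ℓ := Nat.cast_nonneg _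
  set q : ℝ := 1 - κ / 2 with hq
  have hq0 : 0 ≤ q := by rw [hq]; linarith
  have hq1 : q < 1 := by rw [hq]; linarith
  have hρκ : 0 ≤ 2 * ρ / κ := div_nonneg (by linarith) hκpos.le
  have hδ2 : deltaSU n / 2 < deltaSU n := by have := deltaSU_pos (n := n); linarith
  -- `K 1 = Ū(U₀)(c)`
  have hK1 : K 1 = avgFun (expMeanLogSU (n := n)) U₀ c := by
    simp only [hKdef, one_mul, Function.update_eq_self]
  -- the Newton sequence
  set F : Matrix.specialUnitaryGroup n ℂ → Matrix.specialUnitaryGroup n ℂ := fun g => (T * (K g)⁻¹) * g with hF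
  set seq : ℕ → Matrix.specialUnitaryGroup n ℂ := fun k => F^[k] 1 with hseq
  have hseq0 : seq 0 = 1 := rfl
  have hseqS : ∀ k, seq (k + 1) = (T * (K (seq k))⁻¹) * seq k := fun k => by
    rw [hseq]; exact Function.iterate_succ_apply' F k 1
  -- one-step matrix facts
  have hstep_norm : ∀ g : Matrix.specialUnitaryGroup n ℂ,
      ‖(((T * (K g)⁻¹) * g : Matrix.specialUnitaryGroup n ℂ) : Matrix n n ℂ) - (g : Matrix n n ℂ)‖ ≤
        ‖(T : Matrix n n ℂ) * star ((K g : Matrix.specialUnitaryGroup n ℂ) : Matrix n n ℂ) - 1‖ := by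
    intro g
    have hid : (((T * (K g)⁻¹) * g : Matrix.specialUnitaryGroup n ℂ) : Matrix n n ℂ) - (g : Matrix n n ℂ) =
        ((T : Matrix n n ℂ) * star ((K g : Matrix.specialUnitaryGroup n ℂ) : Matrix n n ℂ) - 1) * (g : Matrix n n ℂ) := by
      rw [Submonoid.coe_mul, Submonoid.coe_mul, sub_mul, one_mul]; rfl
    rw [hid]
    calc _ ≤ ‖(T : Matrix n n ℂ) * star ((K g : Matrix.specialUnitaryGroup n ℂ) : Matrix n n ℂ) - 1‖ * ‖(g : Matrix n n ℂ)‖ :=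
          norm_mul_le _ _
      _ = _ := by rw [CStarRing.norm_of_mem_unitary (Matrix.mem_specialUnitaryGroup_iff.1 g.2).1, mul_one]
  -- THE INVARIANT: residual `≤ q^k ρ`, displacement `≤ (2/κ)(1 − q^k)ρ`
  have inv : ∀ k : ℕ,
      ‖(T : Matrix n n ℂ) * star ((K (seq k) : Matrix.specialUnitaryGroup n ℂ) : Matrix n n ℂ) - 1‖ ≤ q ^ k * ρ ∧
        ‖(↑(seq k) : Matrix n n ℂ) - 1‖ ≤ 2 / κ * (1 - q ^ k) * ρ := by
    intro k
    induction k with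
    | zero =>
      refine ⟨?_, ?_⟩
      · rw [hseq0, hK1, pow_zero, one_mul]; exact hT
      · rw [hseq0]; simp
    | succ k ih =>
      obtain ⟨hr, hg⟩ := ih
      have hqk : q ^ k ≤ 1 := pow_le_one₀ hq0 hq1.le
      have hqk0 : 0 ≤ q ^ k := pow_nonneg hq0 k
      have hgk : dist1 (seq k) ≤ 2 * ρ / κ := by
        rw [FederbushMean.dist1_SU_eq]
        refine hg.trans ?_
        have : 2 / κ * (1 - q ^ k) * ρ ≤ 2 / κ * 1 * ρ :=
          mul_le_mul_of_nonneg_right (mul_le_mul_of_nonneg_left (by linarith) (by positivity)) hρ0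
        calc _ ≤ 2 / κ * 1 * ρ := this
          _ = 2 * ρ / κ := by ring
      have hrk : q ^ k * ρ ≤ ρ := mul_le_of_le_one_left hρ0 hqk
      have hℓrk : ℓ * (q ^ k * ρ) ≤ ℓ * ρ := mul_le_mul_of_nonneg_left hrk hℓ0
      -- the Newton step at `seq k`
      have h24 : α + dist1 (seq k) ≤ 1 / 24 := by linarith
      have h48 : 48 * (ℓ * (q ^ k * ρ)) ≤ 1 := by linarith
      have hN : 2 * (ℓ * (q ^ k * ρ)) + (α + dist1 (seq k)) < deltaSU n := by linarith
      have step := newton_step hj U₀ c hν hα (seq k) T hr h24 h48 hN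
      refine ⟨?_, ?_⟩
      · rw [hseqS]
        refine step.trans ?_
        have hfac : (1 - ((Fintype.card (Idx P) : ℝ))⁻¹ *
              ((Finset.univ.filter fun i : Idx P => (stairWord i.2.1 (off i.1)).head? = some (ν, true)).card : ℝ)) +
            400 * ℓ * (ℓ * (q ^ k * ρ) + (α + dist1 (seq k))) ≤ q := by
          rw [← hκ, hq]
          have h1 : 400 * ℓ * (ℓ * (q ^ k * ρ) + (α + dist1 (seq k))) ≤ 400 * ℓ * (ℓ * ρ + (α + 2 * ρ / κ)) := by
            apply mul_le_mul_of_nonneg_left _ (by positivity)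
            linarith
          linarith
        calc _ ≤ q * (q ^ k * ρ) := mul_le_mul_of_nonneg_right hfac (by positivity)
          _ = q ^ (k + 1) * ρ := by ring
      · rw [hseqS]
        calc ‖(↑((T * (K (seq k))⁻¹) * seq k) : Matrix n n ℂ) - 1‖
            ≤ ‖(↑((T * (K (seq k))⁻¹) * seq k) : Matrix n n ℂ) - (↑(seq k) : Matrix n n ℂ)‖ +
                ‖(↑(seq k) : Matrix n n ℂ) - 1‖ := by
              rw [← sub_add_sub_cancel]; exact norm_add_le _ _
          _ ≤ q ^ k * ρ + 2 / κ * (1 - q ^ k) * ρ := add_le_add ((hstep_norm _).trans hr) hg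
          _ = 2 / κ * (1 - q ^ (k + 1)) * ρ := by rw [hq]; field_simp; ring
  -- Cauchy
  have hcauchy : CauchySeq seq := by
    refine cauchySeq_of_le_geometric q ρ hq1 fun k => ?_
    rw [Subtype.dist_eq, dist_eq_norm, ← norm_neg, neg_sub, hseqS]
    calc _ ≤ _ := hstep_norm (seq k)
      _ ≤ q ^ k * ρ := (inv k).1
      _ = ρ * q ^ k := mul_comm _ _
  obtain ⟨G, hG⟩ := cauchySeq_tendsto_of_complete hcauchy
  -- the limit is within `2ρ/κ` of `1`
  have hGn : ‖(G : Matrix n n ℂ) - 1‖ ≤ 2 * ρ / κ := by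
    have hclosed : IsClosed {g : Matrix.specialUnitaryGroup n ℂ | ‖(g : Matrix n n ℂ) - 1‖ ≤ 2 * ρ / κ} :=
      isClosed_le ((continuous_subtype_val.sub continuous_const).norm) continuous_const
    refine hclosed.mem_of_tendsto hG (Filter.Eventually.of_forall fun k => ?_)
    have := (inv k).2
    have hqk0 : 0 ≤ q ^ k := pow_nonneg hq0 k
    calc _ ≤ 2 / κ * (1 - q ^ k) * ρ := this
      _ ≤ 2 / κ * 1 * ρ := mul_le_mul_of_nonneg_right (mul_le_mul_of_nonneg_left (by linarith) (by positivity)) hρ0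
      _ = 2 * ρ / κ := by ring
  -- `K (seq k) → T`
  have hKT : Tendsto (fun k => ((K (seq k) : Matrix.specialUnitaryGroup n ℂ) : Matrix n n ℂ)) atTop (𝓝 (T : Matrix n n ℂ)) := by
    rw [tendsto_iff_norm_sub_tendsto_zero]
    have hbound : ∀ k, ‖((K (seq k) : Matrix.specialUnitaryGroup n ℂ) : Matrix n n ℂ) - (T : Matrix n n ℂ)‖ ≤ ρ * q ^ k := by
      intro k
      have hKu : ((K (seq k) : Matrix.specialUnitaryGroup n ℂ) : Matrix n n ℂ) ∈ Matrix.unitaryGroup n ℂ :=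
        (Matrix.mem_specialUnitaryGroup_iff.1 (K (seq k)).2).1
      have hid : ((K (seq k) : Matrix.specialUnitaryGroup n ℂ) : Matrix n n ℂ) - (T : Matrix n n ℂ) =
          -(((T : Matrix n n ℂ) * star ((K (seq k) : Matrix.specialUnitaryGroup n ℂ) : Matrix n n ℂ) - 1) *
            ((K (seq k) : Matrix.specialUnitaryGroup n ℂ) : Matrix n n ℂ)) := by
        rw [sub_mul, mul_assoc, Unitary.star_mul_self_of_mem hKu, mul_one, one_mul, neg_sub]
      rw [hid, norm_neg]
      calc _ ≤ ‖(T : Matrix n n ℂ) * star ((K (seq k) : Matrix.specialUnitaryGroup n ℂ) : Matrix n n ℂ) - 1‖ *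
              ‖((K (seq k) : Matrix.specialUnitaryGroup n ℂ) : Matrix n n ℂ)‖ := norm_mul_le _ _
        _ ≤ q ^ k * ρ * 1 := by
            rw [CStarRing.norm_of_mem_unitary hKu]; exact mul_le_mul_of_nonneg_right (inv k).1 zero_le_one
        _ = ρ * q ^ k := by ring
    have hgeo : Tendsto (fun k => ρ * q ^ k) atTop (𝓝 0) := by
      simpa using (tendsto_pow_atTop_nhds_zero_of_lt_one hq0 hq1).const_mul ρ
    exact squeeze_zero (fun k => norm_nonneg _) hbound hgeo
  -- the law is continuous at the limit
  have hKcont : ContinuousAt K G := by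
    have hup : Continuous fun g : Matrix.specialUnitaryGroup n ℂ => Function.update U₀ e (g * U₀ e) :=
      continuous_const.update e (continuous_id.mul continuous_const)
    have hloops : ∀ i, dist1 (loopHol (Function.update U₀ e (G * U₀ e)) c i) < deltaSU n / 2 := fun i => by
      have h1 := dist1_loopHol_update_centreLeg_le hj U₀ c hν G i
      rw [← he] at h1
      have h2 : dist1 G ≤ 2 * ρ / κ := by rw [FederbushMean.dist1_SU_eq]; exact hGn
      have h3 := hα i
      have h4 : 0 ≤ ℓ * ρ := mul_nonneg hℓ0 hρ0
      linarith
    have h1 : ContinuousAt (fun U : GaugeField P j (Matrix.specialUnitaryGroup n ℂ) => avgFun (expMeanLogSU (n := n)) U c)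
        (Function.update U₀ e (G * U₀ e)) := continuousAt_avgFun_apply _ c hloops
    rw [hKdef]
    exact ContinuousAt.comp (g := fun U : GaugeField P j (Matrix.specialUnitaryGroup n ℂ) => avgFun (expMeanLogSU (n := n)) U c)
      (f := fun g : Matrix.specialUnitaryGroup n ℂ => Function.update U₀ e (g * U₀ e)) h1 hup.continuousAt
  have hKG : Tendsto (fun k => ((K (seq k) : Matrix.specialUnitaryGroup n ℂ) : Matrix n n ℂ)) atTop
      (𝓝 ((K G : Matrix.specialUnitaryGroup n ℂ) : Matrix n n ℂ)) :=
    (continuous_subtype_val.continuousAt.tendsto.comp (hKcont.tendsto.comp hG))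
  have hEq : K G = T := Subtype.ext (tendsto_nhds_unique hKG hKT)
  exact ⟨G, hGn, hEq⟩

end Summit.QuantumFields.YangMills.Theorems.FluctuationComparisonRegPrIntLS1aCentreLegSurjective

end
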